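import Summits.MatrixMultiplication.OmegaCensus.SmallFormats.MatMul22nRankGF7Slack5Search
import HarnessLib

/-!
# ω-census family (a): replay of the slack-5 search certificate, CHECK B part 4 of 8 (classes `212 ≤ c < 327`)

Cell `pub-omega` (unit `pub-omega-tensor-g16`), topic `Summits/MatrixMultiplication/OmegaCensus` (sub-folder `SmallFormats`).
Framing (verbatim): lottery ticket; floor = certified bounds/negative ranges. HONEST FRAMING: machine-generated kernel replay
(`pub-omega-tensor-g16/code/gen5_runs.py`): `search5 c = true` for the classes `212 ≤ c < 327` (4296 search nodes in 3 `decide`s).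
Meaning (`search5_sound`, `MatMul22nRankGF7Slack5SearchSound`): no LP-tight point of slack 5 has one of these representatives as torus-0 column.
Nothing here is progress on `ω`.
-/

namespace Summit.MatrixMultiplication.OmegaCensus.SmallFormats

set_option Elab.async false

set_option maxRecDepth 100000 in
set_option maxHeartbeats 400000000 in
/-- Classes `212 ≤ c < 247` (1447 nodes). -/
theorem search5_ok_212_247 : ∀ c : Fin 656, 212 ≤ c.val → c.val < 247 → search5 c.val = true := by decide +kernel

set_option maxRecDepth 100000 in
set_option maxHeartbeats 400000000 in
/-- Classes `247 ≤ c < 292` (1491 nodes). -/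
theorem search5_ok_247_292 : ∀ c : Fin 656, 247 ≤ c.val → c.val < 292 → search5 c.val = true := by decide +kernel

set_option maxRecDepth 100000 in
set_option maxHeartbeats 400000000 in
/-- Classes `292 ≤ c < 327` (1358 nodes). -/
theorem search5_ok_292_327 : ∀ c : Fin 656, 292 ≤ c.val → c.val < 327 → search5 c.val = true := by decide +kernel

/-- CHECK B for the classes `212 ≤ c < 327`. -/
theorem search5_run_4 : ∀ c : Fin 656, 212 ≤ c.val → c.val < 327 → search5 c.val = true := by
  intro c hlo hhi
  by_cases h247 : c.val < 247
  · exact search5_ok_212_247 c (by omega) h247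
  by_cases h292 : c.val < 292
  · exact search5_ok_247_292 c (by omega) h292
  exact search5_ok_292_327 c (by omega) hhi

end Summit.MatrixMultiplication.OmegaCensus.SmallFormats
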